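import Mathlib
import HarnessLib
import HarnessLib.Audit
import Summits.MatrixMultiplication.Statement
import Literature.Computability.AlgebraicComplexity.GroupTheoreticMatMul
import Literature.Computability.AlgebraicComplexity.FlatteningBound
import HarnessLib.Audit.Status.Attr

/-!
Route: ThinBlockAlpha

DORMANT since 2026-08-24T16:03:31Z (reconciler: no traction for 6.9 d (last activity item-evidence-added at 2026-08-17T18:23:25Z); parked, not closed — `ledger route dormant route-MatrixMultiplication-ThinBlockAlpha --off` to reactivate) — unstaffed, not closed; items shared with open routes are served there. `ledger route dormant <id> --off` reactivates.

# Route ThinBlockAlpha — thin-block abelian STPP designs certify the dual exponent alpha = 1 (hence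
omega = 2) where the bounded-exponent barrier is silent

It suffices to show X_thin = `ThinPackings` (card thin-block-loophole-alpha, K1): for every shape
exponent a in [0,1)
and every η > 0 there is a finite abelian group H and an STPP family (A_i, B_i, C_i)_{i<L} in H
(CKSU 2005 Def 5.1 =
tree `IsSTPP`) whose blocks all have ONE THIN SHAPE ⟨N, M, N⟩ with N ≥ 2, M ≥ N^a, and whose two
long legs meet the
packing bound up to the slack N^η: |H| ≤ L · N^{2+η} (note L N² ≤ |H| always). By CKSU Thm 5.5,
abelian case =
BCCGNSU (1.1) (the DISCHARGED tree fact `CohnKleinbergSzegedyUmans2005_5_5_abelian`), such a family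
certifies
L·(N²M)^{ω/3} ≤ |H| ≤ L·N^{2+η}, i.e. (2+a)·ω(ℂ) ≤ 3(2+η) (support item `ThinCertifiesOmega`, the
square form);
letting a → 1, η → 0 gives ω(ℂ) ≤ 2, and ω(ℂ) ≥ 2 is the flattening bound — so ω(ℂ) = 2. The
dual-exponent reading
of the SAME families — for each fixed a < 1 they certify ω(1,a,1) ≤ 2 + η (CKSU Thm 5.5 in rank form
plus
Schönhage's rectangular asymptotic sum inequality, both proved in the tree), hence ω(1,a,1) = 2 for
all a < 1, i.e.
α = 1, and at a = 1/3 already the α-record — is what the bounded-exponent rungs (support items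
BoundedExponentThird,
SkewLocalStrongUSP, USPToBounded: special cases of X_thin outside the cone of `closes`, re-badged
crux → support at rev 3) are FOR; it needs
`omegaRect` and is deliberately kept OUT of this file (cone repair 2026-08-15, rev 1: `omegaRect` is
defined in the
module that carries the undischargeable laser-method record facts, which blocked the route's import
cone), and lives
with route RectangularAlpha (item DAlphaOneThird) and problem-side Theorems files. The distinctive
bet (those support items): for each
FIXED a the witnesses may live in abelian groups of BOUNDED exponent ℓ(a) — dead for ω (BCCGNSU Thm
B) but unbarred
for α below a₀(ℓ) → 1; WITNESSED at a = 2/7 in exponent 9 (null-offset chart over ℤ/9: the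
refutation of the negative twin
RectangularThmB, Theorems/RectangularThmB/Negative/* + p84448), open at a = 1/3 (the α record) and
beyond. The cruxes: X_thin itself (the `closes`
hypothesis, consumed as a → 1; X_thin is monotone in a, so no single rung a < 1 is load-bearing for
ω = 2) and, since rev 4,
the bet typed as a whole, `BoundedThinPackings` (for every a < 1 SOME bounded exponent ℓ(a)
suffices), which feeds X_thin by the
trivial glue `BoundedToThin` and of which BoundedExponentThird (a = 1/3) and the a = 2/7 chart
family are instances.
Lean: `∀ a : ℝ, 0 ≤ a → a < 1 → ∀ η : ℝ, 0 < η → ∃ (H : Type) (_ : AddCommGroup H) (_ : Fintype H)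
(L N M : ℕ) (A B C : Fin L → Finset H), Literature.Computability.AlgebraicComplexity.IsSTPP A B C ∧
(∀ i, (A i).card = N ∧ (B i).card = M ∧ (C i).card = N) ∧ 2 ≤ N ∧ (N : ℝ) ^ a ≤ M ∧ (Fintype.card H
: ℝ) ≤ L * (N : ℝ) ^ (2 + η)`

## Assembly
Pure logic plus two proved, named-fact-free tree theorems (sorry-free in Sketch.lean / glue.lean):
ThinPackings at
a = 1 − t, η = t (0 < t ≤ 1) and ThinCertifiesOmega give (3 − t)·ω(ℂ) ≤ 3(2 + t); with ω(ℂ) ≤ 3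
(`omega_le_three'`, FlatteningBound) this is ω(ℂ) ≤ 2 + 2t for every small t > 0, so ω(ℂ) ≤ 2; ω(ℂ)
≥ 2 is
`omega_two_le` (FlatteningBound); `MatrixMultiplication_iff` closes. Route imports after the cone
repair:
GroupTheoreticMatMul (`IsSTPP`; both named facts of that module are discharged) and FlatteningBound
(no named facts).

Rationale: WHY THIS LINE. Every catalogued group-theoretic barrier is a VOLUME-DEFICIT statement, blind to how
the volume is spread over the
three legs: the tree's effective Thm B (arXiv:1605.06702;
`BlasiakChurchCohnGrochowNaslundSawinUmans2017_B_holds`,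
key inequality Σ vol^{2/3} ≤ |H|^{1−δ_ℓ}) contradicts a thin two-leg packing |H| ≤ L N^{2+o(1)}, M =
N^a, only when
2(1−a)/(2+a) < 3δ_ℓ, i.e. for a > a₀(ℓ) = (2−6δ_ℓ)/(2+3δ_ℓ) (≈ 0.69 already at ℓ = 3, → 1 as ℓ → ∞
since
δ_ℓ = O(1/log ℓ)); the S₃-symmetrised re-run gives the same threshold, and slice rank only sees the
short-leg sum Σ|A_i||B_i| = L N^{1+a}
(Pratt arXiv:2309.03878 Cor 2.10 is a ONE-sum statement). So bounded-exponent abelian designs — the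
only regime where STPP design technology exists (CKSU
arXiv:math/0511460 §3, §6: local strong USPs / charts ⇒ STPP in H₀^k, Thm 33 / Thm 37, both PROVED
in the tree) — are
alive for the DUAL exponent: any
a > 0.321334 beats the α record (arXiv:2307.07970), and a growing group family is outside the CLLZ
T-method cap α ≤ 0.625
(arXiv:2003.03019). Imported areas: additive combinatorics of (ℤ/ℓ)^n (tricolored sum-free sets,
cap-set method as the
map of where NOT to dig), extremal set systems / Sperner capacity (skew local strong USPs:
composition (3k, k, 3k) in
Cyc_7^{7k} gives a = 1/3 EXACTLY, packing tight iff |U| ≥ C(7k,k)·2^{−o(k)}), and the laser method's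
own hashing /
type-count engine transplanted to charts (`exists_free_diagonal_jointType_card`,
LaserMethodTypeCount, PROVED). What prior
routes do not do: RectangularAlpha climbs α with CW_q laser certificates (capped at 0.625);
GroupTheoreticSTPP needs SQUARE
packings in UNBOUNDED exponent; no other route or card reads the abelian barrier at rectangular
shapes.
Cone repair 2026-08-15 (rev 1): the assembly runs through the SQUARE form of CKSU Thm 5.5 (support
ThinCertifiesOmega;
imports GroupTheoreticMatMul + FlatteningBound only, no undischarged named fact in the cone); the
ω(1,a,1)/α reading of the
same designs lives outside this file (route RectangularAlpha, Theorems files), because `omegaRect`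
shares its module with the
undischargeable laser-method record facts (arXiv:2307.07970, arXiv:2404.16349 tables).
Repair 2026-08-16 (rev 3/4, unused-crux): the bounded-exponent rungs are SPECIAL CASES of X_thin and
sit outside the cone
of `closes` (which consumes X_thin only as a → 1; X_thin is monotone in a); BoundedExponentThird,
SkewLocalStrongUSP and
the negative twin RectangularThmB were re-badged crux → support, and the bet was typed as a whole
(crux BoundedThinPackings +
proved glue BoundedToThin).
ROUTE CHOICE 2026-08-16 (rev 6, this edit — the route went BROKEN at 08:41Z when stmt-10597 closed
`refuted`): NEXT LINE =
THE LINE AS DRAWN. The refuted item was the NEGATIVE TWIN: `not_RectangularThmB`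
(Theorems/ThinBlockAlphaRectangularThmBRefutation.lean,
p84448, refuted-substantive) is a CONSTRUCTION — the null-offset chart over ℤ/9 fed to the tree's
hashing theorem gives in
(ℤ/9)^{18m} STPP families of L ≥ 2^{18m·h₀−o(m)} blocks ⟨7^{7m}, 7^{2m}, 7^{7m}⟩ (a = 2/7, h₀ =
log₂9 − (7/9)log₂7 = 0.98641,
2^{18m h₀}·7^{14m} = 9^{18m}) with L·N^{2+η} ≥ |H| for every η > 0 — i.e. the FIRST THEOREM-GRADE
WITNESS of the bet
BoundedThinPackings (its a = 2/7 instance, in exponent 9; by crux-ideator-2's structure-blindness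
computation the same chart
is tight over (ℤ/3)², exponent 3, unformalised). So the pre-registered kill criterion (1) FAILED and
the line is alive:
RectangularThmB is DROPPED from the active items as settled negative knowledge (`ledger negatives`),
the a = 2/7 rung is FILED
as the provable-now support BoundedExponentTwoSevenths (Sketch.lean: proved, rc 0, from
`exists_thin_family` + `stub_growth` +
`exponent_pi_zmod9_le`), the two cruxes and `closes` are unchanged, and the crux chain on
BoundedThinPackings (4 ideas filed
2026-08-16: stratified-tri-tiling-charts, merged-power-charts, chart-portfolios-surplus-transfer,
acyclic-shadow-filtration) is
where the a → 1 mechanism is being hunted. Retiring was rejected: no crux is refuted, and the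
pre-registered condition for
`superseded --by GroupTheoreticSTPP` (BoundedThinPackings refuted, KILL CRITERIA (3)) has not
occurred.

RANKED CRUXES. #2 ThinPackings (crux) — X_thin itself (card K1, summit level): for all a ∈ [0,1) and
η > 0, a finite abelian group H and an STPP family of L blocks of one thin shape ⟨N, M, N⟩, N ≥ 2, M
≥ N^a, with |H| ≤ L·N^{2+η}. Any exponent allowed; the deciding theorem needs nothing more (its
second hypothesis ThinCertifiesOmega is proved), and its only load-bearing regime is a → 1.
[difficulty: open-problem] (why it might fail: Equivalent in strength to ω = 2 (¬ThinPackings ↔ ¬X_C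
proved, Theorems/ThinPackings/Negative/ThinPackingsIffCThesis.lean); for a → 1 it needs unbounded or
growing exponent, where no packing-tight STPP family of ANY shape is known (arXiv:2204.03826 p3);
split/coset designs certify only the trivial ω(1,a,1) ≤ 2 + a; every tame/frame strengthening tried
so far is false or X_C in costume (Theorems/ThinPackings/Negative/*; line
label-weighted-stpp-debordering built to its last stub 2026-08-16).) [arXiv:math/0511460,
arXiv:1605.06702, arXiv:2204.03826, arXiv:2307.07970]
#3 BoundedThinPackings (crux) — THE BET, TYPED: for every a ∈ [0,1) there is an exponent bound ℓ =
ℓ(a) such that for every η > 0 some finite abelian group of exponent ≤ ℓ carries an STPP family of L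
blocks ⟨N, M, N⟩, N ≥ 2, M ≥ N^a, |H| ≤ L·N^{2+η}. It feeds `closes` through the proved glue
BoundedToThin (forget ℓ), so the cone is ThinPackings ← BoundedThinPackings and k stays 1. It is
strictly MORE than X_thin ≡ X_C: by the tree's Thm B no SQUARE near-tight family lives in bounded
exponent, and the 'genuinely thin' costume construction (ThinPackingsGenuinelyThin.lean: one split
block ⟨m,1,m⟩ in (ℤ/m)², m → ∞) is unavailable under an exponent bound, so its witnesses must be
honestly thin designs over a FINITE alphabet — exactly the regime where engines exist, now IN THE
TREE: charts (CKSU Thm 37 + hashing, both proved: a = 2/7 at ℓ = 9 PROVED = support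
BoundedExponentTwoSevenths; the null-offset family over ℤ/ℓ gives only a(ℓ) = 2/(ℓ−2) ↓ 0, tight iff
ℓ ≥ 9; chart portfolios claim a = 0.2929 at exponent 72) and local strong USPs in Cyc_m^{mk} (a =
2/(m−1) ≤ 2/3, conditional on near-capacity USPs); for a → 1 it forces ℓ(a) → ∞ with a < a₀(ℓ) (Thm
B), consistent since a₀(ℓ) → 1, and (planner accounting + card stratified-tri-tiling-charts) a FIXED
chart (X_s, Y_s, Z_s)_{s∈Γ} over H₀ can feed all η only if Σ_s |X_s||Z_s| ≥ |H₀| (type count +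
Jensen), while per-symbol TPP gives |X_s||Y_s||Z_s| ≤ |H₀|, so a → 1 needs ≳ |H₀|^{1/3} BALANCED
symbols whose cells nearly tri-tile H₀ — a stratified near-tri-tiling, the named object of the live
crux ideas. BoundedExponentThird is its a = 1/3 instance, BoundedExponentTwoSevenths its first
closed rung; refuting it is KILL CRITERIA (3) and would itself be a new barrier theorem (bounded
exponent useless for α as well as ω). [difficulty: open-problem] (why it might fail: a two-leg
Theorem B uniform in ℓ at one a < 1 kills it even if X_thin survives in unbounded exponent; engines
stop at a = 2/7 (0.2929 claimed) unconditionally and a ≤ 2/3 conditionally, all with a DEcreasing in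
the alphabet; nothing is known near a → 1.) [arXiv:1605.06702, arXiv:math/0511460, arXiv:2204.03826,
arXiv:1607.00047]
FLOOR: 2 cruxes, both in the cone. X_thin is a sufficient condition for the summit (group-theoretic
packings ⇒ ω = 2 through CKSU 5.5), not a restatement of it; as an ω = 2 statement it is EQUIVALENT
to GroupTheoreticSTPP's target CThesis (square blocks qualify for every a; conversely the
S₃-symmetrised cube of a thin family is a square family of slack (2 − 2a + 3η)/(2 + a) → 0), so what
this route adds is the BOUNDED-EXPONENT content — the crux BoundedThinPackings and, below it, the
support-level a-ladder. Recommendation to tenure/assessor: if BoundedThinPackings is refuted (KILL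
CRITERIA (3)) the route degenerates to X_thin ≡ X_C and should be closed `superseded --by`
GroupTheoreticSTPP (or kept dormant as the thin-variant host); the a = 1/3 programme is best
parented by RectangularAlpha.DAlphaOneThird as well (shared items).
#3 BoundedExponentThird (support since rev 3; was crux) — THE RECORD RUNG IN BOUNDED EXPONENT (a =
1/3 plus an exponent bound): there is ℓ such that for every η > 0 some abelian group of exponent ≤ ℓ
carries an STPP family of L blocks ⟨N, M, N⟩ with N ≥ 2, M ≥ N^{1/3} and |H| ≤ L·N^{2+η}. Its real
payoff is rectangular: with the tree-proved certificate (CKSU Thm 5.5 rank form + Schönhage's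
rectangular ASI) it gives ω(1,1/3,1) = 2 = RectangularAlpha.DAlphaOneThird (α ≥ 1/3 > 0.321334, a
publishable record) — RECOMMENDED to RectangularAlpha's planner as a child of DAlphaOneThird (item
stmt-MatrixMultiplication-10596 keeps its evidence: tame-charts line, stubs 1–4 proved, rigid-chart
censuses: 0 thin charts in all abelian groups of order ≤ 13 with |A_π|,|C_π| ≤ 5). [difficulty: XL]
(why it might fail: a two-leg Theorem B AT a = 1/3 may still hold for every ℓ — the 2/7 and 0.2929
witnesses do not reach 1/3 (Inner is monotone in a the wrong way); no thin design at a = 1/3 is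
known.) [arXiv:1605.06702, arXiv:math/0511460, arXiv:2307.07970, arXiv:2003.03019]
#5 SkewLocalStrongUSP (support since rev 3; was crux) — THE a = 1/3 USP ENGINE: for every δ > 0 and
infinitely many k a local strong USP U ⊆ {1,2,3}^{7k} (CKSU §6.1) all of whose rows have exactly 3k
ones, k twos, 3k threes, with |U| ≥ C(7k,k)·2^{−δk}; via CKSU Thm 33 in Cyc_7^{7k} the blocks are
⟨6^{3k}, 6^k, 6^{3k}⟩ (a = 1/3 exactly) and the packing is tight (proved glue USPToBounded). Travels
with BoundedExponentThird. Data (item evidence): width 7 exact maximum 4 vs cap 7; width 14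
LP-certified 47–48 vs cap 91; graded width-7 ceiling rate ≤ 1.5010 vs needed 2^{h(1/7)} = 1.507;
line Concat: transfer proved, rung δ = 3/5 (rate 1.42411) counted. [difficulty: L] (why it might
fail: It asks for a 2^{−o(k)} fraction of the whole weight class C(7k,k); in the balanced class this
is exactly the false strong-USP conjecture (arXiv:1605.06702 §1), and the small-width maxima already
sit near half the cap.) [arXiv:math/0511460, arXiv:1605.06702, arXiv:2301.00074, arXiv:2307.06463]
#9 BoundedExponentTwoSevenths (support, NEW at rev 6, PROVABLE NOW) — the ladder's first closed
rung: there is ℓ such that for every η > 0 some abelian group of exponent ≤ ℓ carries an STPP family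
of L blocks ⟨N, M, N⟩, N ≥ 2, M ≥ N^{2/7}, |H| ≤ L·N^{2+η} (ℓ = 9: the null-offset chart family of
not_RectangularThmB; planner's Sketch.lean proof `⟨9, exists_thin_family + stub_growth +
exponent_pi_zmod9_le⟩`, 20 lines, rc 0, attached as item evidence). The a = 2/7 instance of
BoundedThinPackings verbatim; records the positive content of the refutation inside the route.
PROVER NOTE: `exists_thin_family` lives in Theorems/ThinBlockAlphaRectangularThmBRefutation.lean,
which `open`s this file's namespace and ends with `not_RectangularThmB : ¬ RectangularThmB`; after
rev 6 that constant is no longer rendered here, so re-declare `def RectangularThmB : Prop := <ledger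
signature verbatim>` in namespace …Theses.ThinBlockAlpha at the top of that file (the standard
record patch, cf. Theorems/LevelGradedCohnUmansLevelTwoBeatsCubesRefutation.lean; same for
RectangularThmB/Negative/LoadBearing.lean) and import it. [difficulty: provable-now]
[arXiv:math/0511460, arXiv:1605.06702]
#9 ThinCertifiesOmega (support, PROVED — thinCertifiesOmega_proof) — BOOKKEEPING, SQUARE FORM: a
thin STPP family of L blocks ⟨N, M, N⟩, N ≥ 2, M ≥ N^a (0 ≤ a ≤ 1), |H| ≤ L·N^{2+η} in a finite
abelian H certifies (2 + a)·ω(ℂ) ≤ 3(2 + η) — CKSU Thm 5.5 abelian = BCCGNSU (1.1), the DISCHARGED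
tree fact `CohnKleinbergSzegedyUmans2005_5_5_abelian`. The second hypothesis of `closes`.
[difficulty: proved] [arXiv:math/0511460, arXiv:1605.06702, Blaser2013]
#9 USPToBounded (support, PROVED — uspToBounded_proof) — CKSU Thm 33 at ℓ = 7 plus counting:
SkewLocalStrongUSP → BoundedExponentThird. #9 BoundedToThin (support, PROVED — boundedToThin_proof)
— forget the exponent bound: BoundedThinPackings → ThinPackings. [difficulty: proved]
[arXiv:math/0511460]
EX-ITEM RectangularThmB (support r4, ex-crux; REFUTED-substantive by not_RectangularThmB, p84448;
DROPPED at rev 6): '∀ ℓ ∀ a ∈ (0,1) ∃ η > 0: no exponent-≤ ℓ abelian STPP family ⟨N, M, N⟩, N ≥ 2, M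
≥ N^a, has |H| ≤ L·N^{2+η}' — FALSE at (ℓ, a) = (9, 2/7), hence for all ℓ ≥ 9, a ≤ 2/7
(Inner.mono_a/anti_ell); true remnants: the fat range a > a₀(ℓ) (inner_of_thmB, proved) and possibly
single instances such as a = 1/3. Indexed in `ledger negatives`, never re-filed in any wording; its
uniform-in-ℓ survivor is literally ¬BoundedThinPackings (KILL CRITERIA (3)) — the disprover's
target, not an item.

TWO-LAYER PLAN. Installed at rev 4: BoundedThinPackings → ThinPackings (glue BoundedToThin, proved).
Below BoundedThinPackings no glued split is installed: the a-LADDER (a = 2/7: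
BoundedExponentTwoSevenths, closed-grade; a = 1/3: BoundedExponentThird ⇐ SkewLocalStrongUSP via the
proved USPToBounded, open; USP rungs a = 2/(m−1) ≤ 2/3) consists of SPECIAL CASES — X_thin and
BoundedThinPackings are monotone in a — so a split 'rung + tail(a > rung) → parent' carries the rung
as an idle premise and is not filed (costume). A genuine second layer must cut the a → 1 regime
itself — shape: (E) a growing-alphabet design-family statement (a chart family indexed by a over
base groups H₀(a) whose size AND exponent grow with a, with its local-USP/hashing certificate — the
stratified near-tri-tiling of the crux ideas — or another engine) and (C) the construction glue E →
BoundedThinPackings (CKSU Thm 37 + hashing, both proved) — and is filed only when E is typed by the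
crux chain (crux-plan skeleton with `BoundedThinPackings_of`) and is not X_thin reworded. The a =
1/3 programme's natural second parent is RectangularAlpha.DAlphaOneThird (stmt-0606):
BoundedExponentThird → DAlphaOneThird by the tree-proved rectangular certificate (a Theorems file
may import RectangularExponentBounds; this Theses file may not).

KILL CRITERIA. (1) EXECUTED 2026-08-16 (rev 6): the negative twin RectangularThmB closed `refuted`
(not_RectangularThmB, p84448) — the kill criterion FAILED, the line is alive; the item is dropped,
the statement is negative knowledge, nothing else changes. (2) ThinPackings refuted for some a < 1
(no abelian thin family at all beyond some slack η₀(a) > 0) ⇒ close `refuted:ThinPackings` — that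
theorem would be the first barrier against abelian STPP certifying α = 1 and a catalogue entry. (3)
The uniform-in-ℓ two-leg Theorem B — ∃ a < 1 ∀ ℓ ∃ η > 0, Inner ℓ a η
(Theorems/RectangularThmB/Negative/LoadBearing.lean notation; necessarily a > 2/7 now, > 0.2929 if
the portfolio rung lands) — is exactly ¬BoundedThinPackings: it REFUTES that crux (and
BoundedExponentThird if a ≤ 1/3) but NOT X_thin, which lets the exponent grow: then drop
BoundedThinPackings, BoundedToThin and the rungs, after which the route is X_thin ≡ X_C only and
should be closed `superseded --by` GroupTheoreticSTPP (hand over as the thin variant); that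
refutation would be a catalogue-grade barrier theorem. (4) SkewLocalStrongUSP refuted (skew capacity
< 2^{h(1/7)}) ⇒ nothing for `closes`; the a = 1/3 rung pivots to chart families — all support-level
here. (5) ω = 2 or α = 1 proved elsewhere moots the route.

NOT DECOMPOSED YET. The a → 1 MECHANISM (growing base group / growing chart alphabet) — the only
place a load-bearing second crux can come from; owned by the crux chain on BoundedThinPackings
(ideas 2026-08-16: stratified-tri-tiling-charts = inverse analysis naming the object, ℤ/s^d digit
charts with carries as the resource; merged-power-charts = CW's higher-power move on charts;
chart-portfolios-surplus-transfer = joint hashing of several charts, first target a = 0.2929 @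
exponent 72; acyclic-shadow-filtration = swap-digraph acyclicity, director-field box charts); a
typed E enters this file only through a triaged crux-plan line. Also left: hosts beyond Cyc_7^{7k} /
(ℤ/9)^n for middle rungs; the general-m USP rungs; the card's K3 (thin TPP triples in nonabelian
hosts with d_max = |G|^θ, θ ≪ a/4 — needs maxCharDegree bookkeeping, a different cost side); the a =
0 structure theorem / KSS coset tilings (certify nothing); the sanity lemma 'Thm B's inequality is
implied by the packing bound for a ≤ a₀(ℓ)' (provable now, not load-bearing); dyadic uniformisation
of block sizes (one shape per family loses only N^{o(1)}); the re-homing of the a = 1/3 programme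
(10596, 10598, 10600) under RectangularAlpha.DAlphaOneThird; the record patch re-declaring the
dropped constant RectangularThmB inside the Theorems files that name it (prover/operator hygiene,
see BoundedExponentTwoSevenths).

CHEAPEST FALSIFIER. (i) Re-run BCCGNSU §3.2 (S₃-symmetrised tensor cube + Thm 3.3 + Thm A) with
unbalanced legs — DONE: Thm B bites iff N^{2(1−a)} < |H|^{3δ_ℓ}, i.e. only for a > a₀(ℓ); no kill.
(ii) Finite USP searches — RAN: width 7 exact maximum 4 (cap 7), width 14 LP-certified 47–48 (cap
91): evidence against SkewLocalStrongUSP as stated, none against X_thin. (iii) Counting refutations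
of a rung: impossible at a ≤ 2/7 in exponent ≥ 9 (¬RectangularThmB, now a theorem), so any
refutation of BoundedExponentThird must use a = 1/3-specific structure. (iv) For every proposed
FIXED chart: the one-line necessary checks Σ_s |X_s||Z_s| ≥ |H₀| and a = Σ_s Q_s log|Y_s| / (½ Σ_s
Q_s log(|X_s||Z_s|)) at the intended composition, then the exact-LP trapping analyser of the crux
folder (chartlab.py; ℤ/8 margin −0.0613 @ 1/3, ℤ/9 margin 0 @ 2/7) — seconds per chart. The cheapest
falsifier of the LINE remains KILL CRITERIA (3): a uniform-in-ℓ two-leg Theorem B at some a ∈ (2/7,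
1) — it does not exist, and ¬RectangularThmB shows every argument for it must see a-specific
structure invisible to slice rank, Thm 3.3 extraction and S₃-symmetrisation.

NUMBERS. α ≥ 0.321334 (arXiv:2307.07970 Table 1; cited, never imported here); CW_q T-method cap α ≤
0.625 (arXiv:2003.03019, tree RectangularBarrier); tree Thm B: Σ(|A||B||C|)^{2/3} ≤ |H|^{1−δ_ℓ} ⇒
thin threshold a₀(ℓ) = (2−6δ_ℓ)/(2+3δ_ℓ): δ₂ ≈ 0.082, δ₃ ≈ 0.0775 ⇒ a₀ ≈ 0.67 / 0.69, δ_ℓ = O(1/log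
ℓ) ⇒ a₀(ℓ) → 1. USP rung m: a = 2/(m−1), packing identity Σ_j C(mk,j)(m−1)^{mk−j} = m^{mk}, maximal
term j = k; m = 7 ⇒ a = 1/3, needed rate 2^{h(1/7)} = 1.507. Null-offset chart rung ℓ: composition
((ℓ−2)/2ℓ, 1/ℓ, (ℓ−2)/2ℓ, 1/ℓ), a(ℓ) = 2/(ℓ−2), tight iff H((ℓ−2)/ℓ, 1/ℓ, 1/ℓ) ≤ 1 iff ℓ ≥ 9; ℓ = 9:
n = 18m, blocks ⟨7^{7m}, 7^{2m}, 7^{7m}⟩, log₂L/n → log₂9 − (7/9)·log₂7 = 0.98641, L·N² =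
9^n·2^{−o(n)}; tightness eta_le_a: any admissible η(ℓ,a) ≤ a for ℓ ≥ 2. TPP volume forces L ≥ N^a
blocks. Item counts: open 7 (4 cruxes); rev 3/4: 2 cruxes, 6 support, 1 assembly; rev 6 (route
choice): RectangularThmB dropped (refuted), BoundedExponentTwoSevenths added (support, provable now)
⇒ 2 cruxes, 6 support (BoundedExponentThird, SkewLocalStrongUSP open; BoundedExponentTwoSevenths
provable-now; USPToBounded, ThinCertifiesOmega, BoundedToThin proved), 1 assembly (proved) = 9
active items; closes : ThinPackings → ThinCertifiesOmega → MatrixMultiplication unchanged (glue: (3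
− t)ω ≤ 6 + 3t and ω ≤ 3 ⇒ ω ≤ 2 + 2t), cone ThinPackings ← BoundedThinPackings, k = 1.

DEFINITION REQUESTS. None: `IsSTPP`, `omega`, `AddMonoid.exponent` exist (`omegaRect`,
`dualExponentAlpha` too, for the α-reading outside this file); chart notions (`ChartSolvable`,
`SymbolTPP`, `IsLocalChartUSP`) and local strong USPs (`IsLocalStrongUSP`) are in the tree
(Theorems/ThinBlockAlphaRectangularThmBChartSTPP.lean, Literature LocalStrongUSP.lean) for the crux
lines; the card's D1 (`IsThinSTPP`, thin capacity) stays inlined in the statements.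

Novelty: Searches (2026-08-15): `lit galaxy search "rectangular matrix multiplication group-theoretic" --star
all` (0 hits);
`lit galaxy search "strong uniquely solvable puzzle" --star all` (2: SAT 2020 and COCOON 2023
proceedings = Anderson et
al.); `lit galaxy search "group-theoretic approach to matrix multiplication" --star pdf` (14: Sawin
arXiv:1702.00905,
BCGPU ITCS 2025, none rectangular); `lit search --source arxiv "uniquely solvable puzzle matrix
multiplication"`
(arXiv:2307.06463, arXiv:2301.00074 — balanced small-width SUSP search/verification, no skew
compositions, grep
'rectangular|skew|composition' empty); `lit search --source crossref "group-theoretic … rectangular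
… Pan"` (15:
doi:10.1007/s11425-007-0169-2 Ke–Zeng–Han–Pan 2008 'Fast rectangular matrix multiplication and some
applications',
paywalled, acq-03398 filed — the one candidate for a pre-2016 group-theoretic treatment of
rectangular shapes; it
predates the barrier it would have to read); `lit search --source zbmath` (2, irrelevant); `lit
frontier
MatrixMultiplication --since 2023` (30 rows, none group-theoretic-rectangular); `lit read
arxiv:math/0511460` pp.5–6,10
(Thm 33, Prop 34 page-checked); searchd hybrid / OpenAlex / S2 unavailable (rc 75 / HTTP 429) this
session; hub
Theses/*.lean grep (omegaRect ∧ STPP: only EPRFaces' remark on fat shapes ⟨m,m,m²⟩); `ledger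
negatives` (0).
Nearest prior art found: arXiv:1605.06702 Thm B / Lemma 2.4 (square reading of the barrier;
tree-proved),
arXiv:math/0511460 Thm 5.5  [refs: 10.1007/s11425-007-0169-2, 1702.00905, 2307.06463, 2301.00074, math/0511460, 1605.06702, 2309.03878, 2003.03019, doi:10.1007/s11425-007-0169-2, arxiv:math/0511460]

Barriers (technique_class: group-theoretic-approach, abelian-STPP, rectangular-shapes): - technique_class: group-theoretic-approach, abelian-STPP, rectangular-shapes
- Literature.Barriers.MatrixMultiplication.TricoloredSumFreeBarrier: evaded BY ITS OWN STATEMENT for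
a ≤ a₀(ℓ): the tree's Thm B (Σ vol^{2/3} ≤ |H|^{1−δ_ℓ}) and its S₃-symmetrised re-run bite only when
N^{2(1−a)} < |H|^{3δ_ℓ}; BoundedExponentThird (a = 1/3 < a₀(ℓ) for all ℓ ≥ 2) and SkewLocalStrongUSP
(checked against the Thm-B caps at ℓ = 2, 3, 7) pass its letter; conceded for a > a₀(ℓ), which is
why ThinPackings/BoundedThinPackings let the exponent grow with a; the two-leg strengthening of the
barrier (ex-item RectangularThmB: 'bounded exponent kills every thin shape at some slack') is
REFUTED at (ℓ, a) = (9, 2/7) by a construction (not_RectangularThmB, 2026-08-16) — below a₀(ℓ) the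
barrier is not merely silent but beaten; its uniform-in-ℓ survivor is ¬BoundedThinPackings itself
(kill criterion (3)).
- Literature.Barriers.MatrixMultiplication.BoundedRankFrameBarrier: not in play — its class is
bounded-RANK hosts F_q^m (m fixed, q → ∞) with punctured-subspace ('frame') blocks, where it proves
a power-saving packing defect (no ω < 2 + ε_m certificate); this route's designs are the opposite
regime — bounded EXPONENT with rank n → ∞ ((ℤ/9)^n, Cyc_7^{7k}, (ℤ/ℓ)^n) and product-set blocks
generated by finite charts / local USPs, never frames — and for ThinPackings in unbounded exponent
the frame regime is conceded as dead (cf. the route's own negatives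
Theorems/ThinPackings/Negative/ThinPackingsStrengthe

History (route lifecycle, newest last):
- 2026-08-15T16:35:28Z · rev 1: restated Assembly (stmt-MatrixMultiplication-10601) — cone repair (rrepair guardrail): imports := GroupTheoreticMatMul + FlatteningBound (drop RectangularExponentAlpha, whose cone holds omegaRect's module with 5 un (planner-rrepair-MatrixMultiplication-ThinBlock-003952cd-0)
- 2026-08-15T16:35:28Z · rev 1: dropped ThinCertifies — cone repair (rrepair guardrail): imports := GroupTheoreticMatMul + FlatteningBound (drop RectangularExponentAlpha, whose cone holds omegaRect's module with 5 un (planner-rrepair-MatrixMultiplication-ThinBlock-003952cd-0)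
- 2026-08-16T08:41:30Z · BROKEN — RectangularThmB (stmt-MatrixMultiplication-10597, support) refuted by Summit.MatrixMultiplication.MatrixMultiplication.Theorems.not_RectangularThmB (prover-line-stmt-MatrixMultiplication-10597-0)
- 2026-08-16T08:57:21Z · rev 6: dropped RectangularThmB — route-choice after BROKEN (rchoice unit, 2026-08-16): NEXT LINE = the line as drawn. The refuted item RectangularThmB (stmt-10597, support r4, ex-crux) was the (planner-rchoice-MatrixMultiplication-ThinBlock-25b92f91-0)
- 2026-08-16T08:57:21Z · REPAIRED (drop RectangularThmB; add BoundedExponentTwoSevenths) — back to open: route-choice after BROKEN (rchoice unit, 2026-08-16): NEXT LINE = the line as drawn. The refuted item RectangularThmB (stmt-10597, support r4, ex-crux) was the (planner-rchoice-MatrixMultiplication-ThinBlock-25b92f91-0)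
- 2026-08-24T16:03:31Z · DORMANT — reconciler: no traction for 6.9 d (last activity item-evidence-added at 2026-08-17T18:23:25Z); parked, not closed — `ledger route dormant route-MatrixMultiplica (operator:999:2761855)

sub-problem: MatrixMultiplication · status: dormant · opened planner-plancard-MatrixMultiplication-MatrixM-fb21e6b0-0 2026-08-15T16:19:09Z · rev 9 · ledger route-MatrixMultiplication-ThinBlockAlpha
GENERATED by the gate from the ledger (D-0016/17). Provers cite these decls: `theorem foo : Summit.MatrixMultiplication.MatrixMultiplication.Theses.ThinBlockAlpha.<Decl> := …` in Summits/MatrixMultiplication/MatrixMultiplication/Theorems/<Name>.lean.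
-/

namespace Summit.MatrixMultiplication.MatrixMultiplication.Theses.ThinBlockAlpha

open scoped BigOperators Topology Manifold Classical MeasureTheory ProbabilityTheory Matrix InnerProductSpace ComplexConjugate ContinuousMap
open Filter Set Function TopologicalSpace MeasureTheory

attribute [summit_statement] _root_.MatrixMultiplication

/-- item stmt-MatrixMultiplication-10595 · crux · rank 2 · open · by planner
why it might fail: Equivalent in strength to ω = 2 (¬ThinPackings ↔ ¬X_C proved); for a → 1 it needs unbounded or growing exponent, where no packing-tight STPP family of ANY shape is known (arXiv:2204.03826 p3); every tame/frame strengthening tried so far is false or X_C in costume.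
sources: arXiv:math/0511460, arXiv:1605.06702, arXiv:2204.03826, arXiv:2307.07970
[crux] X_thin itself (card K1, summit level): for all a ∈ [0,1) and η > 0, a finite abelian group H
and an STPP family of L blocks of one thin shape ⟨N, M, N⟩, N ≥ 2, M ≥ N^a, with |H| ≤ L·N^{2+η}.
Any exponent allowed here (the assembly needs nothing more); cruxes 3–5 are the bounded-exponent
programme that is supposed to produce the witnesses. [difficulty: open-problem] -/
@[route_item "route-MatrixMultiplication-ThinBlockAlpha", crux]
def ThinPackings : Prop :=
  ∀ a : ℝ, 0 ≤ a → a < 1 → ∀ η : ℝ, 0 < η → ∃ (H : Type) (_ : AddCommGroup H) (_ : Fintype H) (L N M : ℕ) (A B C : Fin L → Finset H), Literature.Computability.AlgebraicComplexity.IsSTPP A B C ∧ (∀ i, (A i).card = N ∧ (B i).card = M ∧ (C i).card = N) ∧ 2 ≤ N ∧ (N : ℝ) ^ a ≤ M ∧ (Fintype.card H : ℝ) ≤ L * (N : ℝ) ^ (2 + η)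

/-- item stmt-MatrixMultiplication-14848 · crux · rank 3 · open · by planner
why it might fail: A two-leg Theorem B uniform in ℓ at one a < 1 (= ¬BoundedThinPackings) kills it even if X_thin survives in unbounded exponent; engines give a = 2/7 proved (0.2929 claimed) and a ≤ 2/3 conditionally, all with a DEcreasing in the alphabet; nothing is known near a → 1, where ℓ(a) → ∞ is forced.
sources: arXiv:1605.06702, arXiv:math/0511460, arXiv:2204.03826, arXiv:1607.00047
[crux] THE BET, TYPED (rev 4): for every a ∈ [0,1) there is an exponent bound ℓ = ℓ(a) such that for
every η > 0 some finite abelian group of exponent ≤ ℓ carries an STPP family of L blocks ⟨N, M, N⟩,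
N ≥ 2, M ≥ N^a, |H| ≤ L·N^{2+η}. Feeds closes via BoundedToThin (forget ℓ); strictly more than
X_thin ≡ X_C (Thm B: no square near-tight family in bounded exponent; the split-block costume needs
(ℤ/m)², m → ∞), so witnesses are honestly thin finite-alphabet designs; instances: a = 2/7 at ℓ = 9
(not_RectangularThmB's exists_thin_family, theorem-grade), a = 1/3 = BoundedExponentThird (open, the
α record), a = 2/(m−1) ≤ 2/3 conditionally on near-capacity skew local USPs. Refutation target: a
two-leg Theorem B uniform in ℓ at one a < 1 (KILL CRITERIA (3)). [deps: ThinPackings] [difficulty: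
open-problem] -/
@[route_item "route-MatrixMultiplication-ThinBlockAlpha"]
def BoundedThinPackings : Prop :=
  ∀ a : ℝ, 0 ≤ a → a < 1 → ∃ ℓ : ℕ, ∀ η : ℝ, 0 < η → ∃ (H : Type) (_ : AddCommGroup H) (_ : Fintype H) (L N M : ℕ) (A B C : Fin L → Finset H), AddMonoid.exponent H ≤ ℓ ∧ Literature.Computability.AlgebraicComplexity.IsSTPP A B C ∧ (∀ i, (A i).card = N ∧ (B i).card = M ∧ (C i).card = N) ∧ 2 ≤ N ∧ (N : ℝ) ^ a ≤ M ∧ (Fintype.card H : ℝ) ≤ L * (N : ℝ) ^ (2 + η)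

/-- item stmt-MatrixMultiplication-10596 · support · rank 3 · open · by planner
why it might fail: A 'two-leg Theorem B' (crux RectangularThmB) may hold: the B-leg cross-conditions (Z_i + (B_i − B_i)) ∩ Z = ∅, (A_i − A_j) ∩ (B_i − B_j) = ∅ could force Σ|A_i||C_i| ≤ |H|^{1−κ_ℓ} once L ≥ N^{1/3} blocks are needed; no thin design is known.
sources: arXiv:1605.06702, arXiv:math/0511460, arXiv:2307.07970, arXiv:2003.03019
[crux] THE RECORD RUNG IN BOUNDED EXPONENT (card K1 at a = 1/3 > 0.321334): there is ℓ such that for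
every η > 0 some abelian group of exponent ≤ ℓ carries an STPP family of L blocks ⟨N, M, N⟩ with N ≥
2, M ≥ N^{1/3} and |H| ≤ L·N^{2+η}. With ThinCertifies it gives ω(1,1/3,1) = 2 (=
RectangularAlpha.DAlphaOneThird, α ≥ 1/3, a publishable record) from designs Thm B declares useless
for ω; unbarred since 1/3 < a₀(ℓ) for every ℓ ≥ 2. [difficulty: XL] -/
@[route_item "route-MatrixMultiplication-ThinBlockAlpha"]
def BoundedExponentThird : Prop :=
  ∃ ℓ : ℕ, ∀ η : ℝ, 0 < η → ∃ (H : Type) (_ : AddCommGroup H) (_ : Fintype H) (L N M : ℕ) (A B C : Fin L → Finset H), AddMonoid.exponent H ≤ ℓ ∧ Literature.Computability.AlgebraicComplexity.IsSTPP A B C ∧ (∀ i, (A i).card = N ∧ (B i).card = M ∧ (C i).card = N) ∧ 2 ≤ N ∧ (N : ℝ) ^ (1 / 3 : ℝ) ≤ M ∧ (Fintype.card H : ℝ) ≤ L * (N : ℝ) ^ (2 + η)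

/-- item stmt-MatrixMultiplication-10598 · support · rank 5 · open · by planner
why it might fail: It asks for a 2^{−o(k)} fraction of the whole weight class C(7k,k) (the unique-pieces bound); in the balanced class this is exactly the false strong-USP conjecture (arXiv:1605.06702 §1), and the skew Sperner capacity may sit strictly below 2^{h(1/7)} too.
sources: arXiv:math/0511460, arXiv:1605.06702, arXiv:2301.00074, arXiv:2307.06463
[crux] THE ENGINE (card K2 as restated by triage-24): skew local strong USPs of near-binomial size —
for every δ > 0 and infinitely many k there is a local strong USP U ⊆ {1,2,3}^{7k} (CKSU §6.1 p.10:
every triple of rows u,v,w not all equal has a column with pattern in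
{(1,2,1),(1,2,2),(1,1,3),(1,3,3),(2,2,3),(3,2,3)}; symbols coded 0,1,2 below) all of whose rows have
exactly 3k ones, k twos, 3k threes, with |U| ≥ C(7k,k)·2^{−δk}. Via CKSU Thm 33 in Cyc_7^{7k} the
blocks are ⟨6^{3k}, 6^k, 6^{3k}⟩ (a = 1/3 exactly) and the packing |U|·6^{6k} ≥
7^{7k}·2^{−δk}/(7k+1) is tight (support USPToBounded). [difficulty: L] -/
@[route_item "route-MatrixMultiplication-ThinBlockAlpha"]
def SkewLocalStrongUSP : Prop :=
  ∀ δ : ℝ, 0 < δ → ∀ k₀ : ℕ, ∃ k : ℕ, k₀ ≤ k ∧ ∃ U : Finset (Fin (7 * k) → Fin 3), (∀ u ∈ U, ∀ v ∈ U, ∀ w ∈ U, (u ≠ v ∨ v ≠ w) → ∃ i, (u i, v i, w i) ∈ ({((0 : Fin 3), (1 : Fin 3), (0 : Fin 3)), (0, 1, 1), (0, 0, 2), (0, 2, 2), (1, 1, 2), (2, 1, 2)} : Finset (Fin 3 × Fin 3 × Fin 3))) ∧ (∀ u ∈ U, (Finset.univ.filter fun i => u i = 0).card = 3 * k ∧ (Finset.univ.filter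 fun i => u i = 1).card = k) ∧ (Nat.choose (7 * k) k : ℝ) ≤ (2 : ℝ) ^ (δ * k) * U.card

/-- item stmt-MatrixMultiplication-10600 · support · rank 9 · closed · proved by Summit.MatrixMultiplication.MatrixMultiplication.Theorems.uspToBounded_proof (prover) · by planner
sources: arXiv:math/0511460
[support] CKSU Thm 33 at ℓ = 7 plus counting: SkewLocalStrongUSP → BoundedExponentThird (A_u, B_u,
C_u ⊆ Cyc_7^{7k} supported exactly where u = 1, 2, 3; |A_u| = |C_u| = 6^{3k}, |B_u| = 6^k =
|A_u|^{1/3}; exponent 7; |H| = 7^{7k} ≤ (7k+1)·C(7k,k)·6^{6k} ≤ |U|·6^{6k}·N^η once 2^{δk}(7k+1) ≤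
6^{3kη}). [difficulty: M] -/
@[route_item "route-MatrixMultiplication-ThinBlockAlpha"]
def USPToBounded : Prop :=
  SkewLocalStrongUSP → BoundedExponentThird

/-- item stmt-MatrixMultiplication-10938 · support · rank 9 · closed · proved by Summit.MatrixMultiplication.MatrixMultiplication.Theorems.thinCertifiesOmega_proof @ f9948608a37d (prover) · by planner
[support] BOOKKEEPING, SQUARE (ω) FORM — cone repair 2026-08-15, replaces ThinCertifies (whose
ω(1,a,1)-form needed `omegaRect`, defined in RectangularExponent.lean next to the five
undischargeable laser-method record facts vxxz2024_*/advxxz2025_*, which blocked the route's import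
cone): a thin STPP family of L blocks ⟨N, M, N⟩, N ≥ 2, M ≥ N^a (0 ≤ a ≤ 1), in a finite abelian
group H with |H| ≤ L·N^{2+η} certifies (2 + a)·ω(ℂ) ≤ 3(2 + η). Proof, provable now: CKSU 2005 Thm
5.5 abelian case = BCCGNSU 2017 (1.1), the DISCHARGED tree fact
`CohnKleinbergSzegedyUmans2005_5_5_abelian` (`_holds` in GroupTheoreticMatMulProofs.lean) gives
L·(N²M)^{ω/3} ≤ |H| ≤ L·N^{2+η}; L = 0 is impossible (|H| ≥ 1); N²M ≥ N^{2+a} (M ≥ N^a ≥ 1) and ω/3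
> 0 give N^{(2+a)ω/3} ≤ N^{2+η}, and N ≥ 2 lets one compare exponents. With ThinPackings at a = 1 −
t, η = t → 0 the deciding theorem `closes` gets (3 − t)ω ≤ 6 + 3t, hence ω(ℂ) ≤ 2 (ω ≤ 3, ω ≥ 2 from
FlatteningBound `omega_le_three'`, `omega_two_le`). PROVER NOTE: prove it importing
GroupTheoreticMatMulProofs (+ FlatteningBound / Mathlib rpow lemmas) only — do NOT import
RectangularExponent*, RectangularExponentBounds/Alpha or TensorMultiples, so the route -/
@[route_item "route-MatrixMultiplication-ThinBlockAlpha", crux]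
def ThinCertifiesOmega : Prop :=
  ∀ a : ℝ, 0 ≤ a → a ≤ 1 → ∀ η : ℝ, 0 < η → ∀ (H : Type) [AddCommGroup H] [Fintype H] (L N M : ℕ) (A B C : Fin L → Finset H), Literature.Computability.AlgebraicComplexity.IsSTPP A B C → (∀ i, (A i).card = N ∧ (B i).card = M ∧ (C i).card = N) → 2 ≤ N → (N : ℝ) ^ a ≤ M → (Fintype.card H : ℝ) ≤ L * (N : ℝ) ^ (2 + η) → (2 + a) * Literature.Computability.AlgebraicComplexity.omega ℂ ≤ 3 * (2 + η)

/-- item stmt-MatrixMultiplication-14849 · support · rank 9 · closed · proved by Summit.MatrixMultiplication.MatrixMultiplication.Theorems.boundedToThin_proof @ 261528be7e92 (prover) · by planner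
sources: arXiv:math/0511460
[support] glue, provable now (forget the exponent bound; Sketch.lean boundedToThin_holds):
BoundedThinPackings → ThinPackings — puts the typed bet in the cone of closes. [deps:
BoundedThinPackings, ThinPackings] [difficulty: provable-now] -/
@[route_item "route-MatrixMultiplication-ThinBlockAlpha"]
def BoundedToThin : Prop :=
  BoundedThinPackings → ThinPackings

/-- item stmt-MatrixMultiplication-15152 · support · rank 9 · closed · proved by Summit.MatrixMultiplication.MatrixMultiplication.Theorems.boundedExponentTwoSevenths_proof @ 90cab0bd1f51 (prover) · by planner
sources: arXiv:math/0511460, arXiv:1605.06702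
[support] FIRST CLOSED RUNG of the bet BoundedThinPackings, PROVABLE NOW (route choice 2026-08-16,
rev 6): there is an exponent bound ℓ such that for every η > 0 some finite abelian group of exponent
≤ ℓ carries an STPP family of L blocks ⟨N, M, N⟩ with N ≥ 2, M ≥ N^{2/7} and |H| ≤ L·N^{2+η} (the
shape of BoundedExponentThird with 1/3 ↦ 2/7; the a = 2/7 instance of BoundedThinPackings verbatim).
Witness ℓ = 9: the null-offset CKSU chart over ℤ/9 fed to the tree's hashing theorem —
Theorems/ThinBlockAlphaRectangularThmBRefutation.lean `exists_thin_family` (STPP families in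
(ℤ/9)^{18m} of blocks ⟨7^{7m}, 7^{2m}, 7^{7m}⟩ with 9^{18m} ≤ L·(7^{7m})^{2+η}) + `stub_growth`
(ThinBlockAlphaRectangularThmBGrowth) + `exponent_pi_zmod9_le` (RectangularThmB/Negative/NullChart);
the planner's 20-line proof (Sketch.lean, lean check rc 0, 0 sorry) is attached as item evidence. It
records inside the route the positive content of the refutation of the ex-item RectangularThmB
(negative twin, dropped at rev 6). PROVER NOTE: the refutation file `open`s this route's namespace
and ends with `not_RectangularThmB : ¬ RectangularThmB`; from rev 6 the constant RectangularThmB is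
no longer rendered in the The -/
@[route_item "route-MatrixMultiplication-ThinBlockAlpha"]
def BoundedExponentTwoSevenths : Prop :=
  ∃ ℓ : ℕ, ∀ η : ℝ, 0 < η → ∃ (H : Type) (_ : AddCommGroup H) (_ : Fintype H) (L N M : ℕ) (A B C : Fin L → Finset H), AddMonoid.exponent H ≤ ℓ ∧ Literature.Computability.AlgebraicComplexity.IsSTPP A B C ∧ (∀ i, (A i).card = N ∧ (B i).card = M ∧ (C i).card = N) ∧ 2 ≤ N ∧ (N : ℝ) ^ (2 / 7 : ℝ) ≤ M ∧ (Fintype.card H : ℝ) ≤ L * (N : ℝ) ^ (2 + η)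

-- earlier Assembly (stmt-MatrixMultiplication-10601, replaced 2026-08-15T16:35:28Z -> stmt-MatrixMultiplication-11004): retired by None — ThinPackings → ThinCertifies → _root_.MatrixMultiplication
/-- item stmt-MatrixMultiplication-11004 · assembly · rank 1 · closed · proved by Summit.MatrixMultiplication.MatrixMultiplication.Theorems.thinBlockAlpha_assembly_proof @ 20a055b94c44 (prover) · by planner
sources: arXiv:math/0511460, Blaser2013
[assembly] ThinPackings → ThinCertifiesOmega → MatrixMultiplication (cone repair 2026-08-15: the
square-form certificate ThinCertifiesOmega replaces ThinCertifies; the deciding theorem `closes` has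
exactly these two hypotheses). -/
@[route_item "route-MatrixMultiplication-ThinBlockAlpha"]
def Assembly : Prop :=
  ThinPackings → ThinCertifiesOmega → _root_.MatrixMultiplication

-- records of items no longer active in this route (dropped / restated):
-- earlier RectangularThmB (stmt-MatrixMultiplication-10597, dropped 2026-08-16T08:57:21Z): refuted by Summit.MatrixMultiplication.MatrixMultiplication.Theorems.not_RectangularThmB — ∀ ℓ : ℕ, ∀ a : ℝ, 0 < a → a < 1 → ∃ η : ℝ, 0 < η ∧ ∀ (H : Type) [AddCommGroup H] [Fintype H], AddMonoid.exponent H ≤ ℓ → ∀ (L N M : ℕ) (A B C : Fin L → Finset H), Literature.Computability.AlgebraicComplexity.IsSTPP A B C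

/-! D-0027 §2.1 — DECIDING THEOREM (planner-authored via `route open/edit --closes-file`; by planner-rrepair-MatrixMultiplication-ThinBlock-003952cd-0 2026-08-15T16:35:28Z):
its hypotheses are this route's items and its conclusion the sub-problem Statement (glue_lint), and it elaborates with this file. -/

@[closes "route-MatrixMultiplication-ThinBlockAlpha"] theorem closes (h₁ : ThinPackings) (h₂ : ThinCertifiesOmega) : _root_.MatrixMultiplication := by
  rw [_root_.MatrixMultiplication_iff]
  have hge : (2 : ℝ) ≤ Literature.Computability.AlgebraicComplexity.omega ℂ :=
    Literature.Computability.AlgebraicComplexity.omega_two_le ℂ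
  have hle3 : Literature.Computability.AlgebraicComplexity.omega ℂ ≤ 3 :=
    Literature.Computability.AlgebraicComplexity.omega_le_three' ℂ
  -- thin packings of shape ⟨N, N^{1-t}, N⟩ with slack N^t certify (3 - t) ω ≤ 3 (2 + t)
  have key : ∀ t : ℝ, 0 < t → t ≤ 1 →
      (3 - t) * Literature.Computability.AlgebraicComplexity.omega ℂ ≤ 3 * (2 + t) := by
    intro t ht0 ht1
    obtain ⟨H, i1, i2, L, N, M, A, B, C, hS, hc, hN, hM, hP⟩ :=
      h₁ (1 - t) (by linarith) (by linarith) t ht0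
    have h := h₂ (1 - t) (by linarith) (by linarith) t ht0 H L N M A B C hS hc hN hM hP
    calc (3 - t) * Literature.Computability.AlgebraicComplexity.omega ℂ
        = (2 + (1 - t)) * Literature.Computability.AlgebraicComplexity.omega ℂ := by ring
      _ ≤ 3 * (2 + t) := h
  refine le_antisymm ?_ hge
  refine le_of_forall_pos_le_add fun ε hε => ?_
  have hm0 : 0 < min ε 1 := lt_min hε one_pos
  have hmε : min ε 1 ≤ ε := min_le_left ε 1
  have hm1 : min ε 1 ≤ 1 := min_le_right ε 1
  have hk := key (min ε 1 / 4) (by positivity) (by linarith)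
  nlinarith [mul_nonneg hm0.le (sub_nonneg.mpr hle3)]

end Summit.MatrixMultiplication.MatrixMultiplication.Theses.ThinBlockAlpha
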